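import Summits.ResolutionOfSingularities.ResolutionOfSingularities.Theorems.WildQuotientsSummitReductionStubPairOrbitNormalFormBlowupModelSing2
import Literature.AlgebraicGeometry.Resolution.FormalNormalCrossingsLemmas
import HarnessLib

/-!
# `WildQuotients.SummitReduction` (stmt-ResolutionOfSingularities-16324), line `FramePerfect`, stub S
# (`stub_pair_orbitNormalFormBlowup`): the centre ideals `(u, v, t_a, t_b)` of the coefficient-free
# model ring are prime, with regular quotient `A/(t_a, t_b)`, and pairwise incomparable

Route `ResolutionOfSingularities/WildQuotients`, crux `SummitReduction`; helper file of the line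
skeleton (v8), stub S = the orbit version of de Jong 1996, Claim 4.27 for
`DeJong1997.QuasiSplitNormalFormPair`. Third sibling of the model-ring files
(`…ModelSing.lean`: `V(u, v, t_a, t_b) ⊆ Sing`; `…ModelSing2.lean`: `Sing ⊆ ⋃ V(u, v, t_a, t_b)`):
with these, the singular locus of `R = A⟦u, v⟧/(uv - t₁ ⋯ t_s)` over a regular local ring `A`
with regular system of parameters `t` is the union of the closed sets of the PRIME ideals
`𝔭_{ab} = (u, v, t_a, t_b)`, `a < b < s`, whose quotients `R/𝔭_{ab} ≅ A/(t_a, t_b)` are regular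
local rings ("`Sing(X) = ⋃ E_α`, with `E_α` regular", de Jong 1997, p. 619; de Jong 1996, 3.5:
"`Eᵢ` is a regular scheme") and which are pairwise incomparable — the dictionary between the
components of `Sing X` through a closed point and the `𝔭_{ab}` used in 4.27 ("its ideal in the
rings of (ii) is given by `(u, v, t₁, t₂)` after renumbering").

* `ker_mk_comp_constantCoeff` — the kernel of `A⟦X⟧ → A → A/𝔞` is `𝔞A⟦X⟧ + (X)`;
* `exists_ringEquiv_nodeDeformationRing_quotient` — for `h ∈ 𝔞`:
  `A⟦u, v⟧/(uv - h)/(u, v, 𝔞) ≅ A/𝔞`;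
* `isPrime_centreIdeal_nodeDeformationRing` — for a regular system of parameters `t` and
  `a ≠ b` with `t_a ∣ h`: `(u, v, t_a, t_b) ⊆ A⟦u, v⟧/(uv - h)` is prime with regular quotient;
* `eq_of_centreIdeal_le` — `𝔭_{ab} ≤ 𝔭_{a'b'}` forces `{a, b} = {a', b'}`;
* `not_isRegularLocalRing_localization_nodeDeformationRing_of_dvd` — the sibling file's
  `V(u, v, x, y) ⊆ Sing` with the divisibility `x y ∣ h` as a hypothesis.

## Sources

* A. J. de Jong, *Smoothness, semi-stability and alterations*, Publ. Math. IHÉS 83 (1996), 3.5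
  (p. 64), 4.27 (p. 75). [DeJong1996]
* A. J. de Jong, *Families of curves and alterations*, Ann. Inst. Fourier 47 (1997), proof of
  Prop. 5.11, p. 619. [DeJong1997]
* H. Matsumura, *Commutative Ring Theory* (1986), Thm. 14.2–14.3. [Matsumura1987]
-/

set_option linter.dupNamespace false -- the tree's summit namespace repeats `ResolutionOfSingularities`

noncomputable section

open IsLocalRing
open Literature.AlgebraicGeometry.Resolution

namespace Summit.ResolutionOfSingularities.ResolutionOfSingularities.Theorems

/-! ## `A⟦X⟧/(𝔞, X) ≅ A/𝔞` -/

/-- **The kernel of `A⟦X₁, …, X_n⟧ → A → A/𝔞`** (constant coefficient, then reduction) is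
`𝔞 A⟦X⟧ + (X₁, …, X_n)`, and the map is surjective. [folklore] -/
theorem ker_mk_comp_constantCoeff {A : Type} [CommRing A] (n : ℕ) (𝔞 : Ideal A) :
    RingHom.ker ((Ideal.Quotient.mk 𝔞).comp (MvPowerSeries.constantCoeff (σ := Fin n) (R := A))) =
      𝔞.map (MvPowerSeries.C (σ := Fin n) (R := A)) ⊔
        Ideal.span (Set.range (MvPowerSeries.X : Fin n → MvPowerSeries (Fin n) A)) ∧
    Function.Surjective
      ((Ideal.Quotient.mk 𝔞).comp (MvPowerSeries.constantCoeff (σ := Fin n) (R := A))) := by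
  refine ⟨le_antisymm ?_ ?_, ?_⟩
  · intro f hf
    rw [RingHom.mem_ker, RingHom.comp_apply, Ideal.Quotient.eq_zero_iff_mem] at hf
    have hsplit : f = MvPowerSeries.C (MvPowerSeries.constantCoeff f) +
        (f - MvPowerSeries.C (MvPowerSeries.constantCoeff f)) := by ring
    rw [hsplit]
    refine Ideal.add_mem _ (Ideal.mem_sup_left (Ideal.mem_map_of_mem _ hf))
      (Ideal.mem_sup_right ?_)
    apply MvPowerSeries.mem_span_range_X_of_constantCoeff_eq_zero
    simp
  · refine sup_le ?_ ?_
    · rw [Ideal.map_le_iff_le_comap]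
      intro c hc
      rw [Ideal.mem_comap, RingHom.mem_ker, RingHom.comp_apply, MvPowerSeries.constantCoeff_C,
        Ideal.Quotient.eq_zero_iff_mem]
      exact hc
    · rw [Ideal.span_le]
      rintro _ ⟨i, rfl⟩
      rw [SetLike.mem_coe, RingHom.mem_ker, RingHom.comp_apply, MvPowerSeries.constantCoeff_X,
        map_zero]
  · intro x
    obtain ⟨c, rfl⟩ := Ideal.Quotient.mk_surjective x
    exact ⟨MvPowerSeries.C c, by rw [RingHom.comp_apply, MvPowerSeries.constantCoeff_C]⟩

/-- The ideal `(u, v) + 𝔞` of the model ring `A⟦u, v⟧/(uv - h)`, written as the image of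
`𝔞A⟦u, v⟧ + (u, v)`. [folklore] -/
theorem map_mk_sup_eq {A : Type} [CommRing A] (h : A) (𝔞 : Ideal A) :
    (𝔞.map (MvPowerSeries.C (σ := Fin 2) (R := A)) ⊔
        Ideal.span (Set.range (MvPowerSeries.X : Fin 2 → MvPowerSeries (Fin 2) A))).map
      (Ideal.Quotient.mk (Ideal.span {DeJong1996.nodeDeformationRelation A h})) =
    𝔞.map (DeJong1996.NodeDeformationRing.ofBase A h) ⊔
      Ideal.span {Ideal.Quotient.mk _ (MvPowerSeries.X 0), Ideal.Quotient.mk _ (MvPowerSeries.X 1)} := by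
  rw [Ideal.map_sup, Ideal.map_map, Ideal.map_span]
  congr 1
  congr 1
  ext x
  simp only [Set.mem_image, Set.mem_range, exists_exists_eq_and, Set.mem_insert_iff,
    Set.mem_singleton_iff]
  constructor
  · rintro ⟨i, rfl⟩
    fin_cases i
    · exact Or.inl rfl
    · exact Or.inr rfl
  · rintro (rfl | rfl)
    · exact ⟨0, rfl⟩
    · exact ⟨1, rfl⟩

/-- **`A⟦u, v⟧/(uv - h)/(u, v, 𝔞) ≅ A/𝔞` for `h ∈ 𝔞`**: the surjection `A⟦u, v⟧ → A/𝔞`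
kills `uv - h`, and its kernel `𝔞A⟦u, v⟧ + (u, v)` maps onto `(u, v) + 𝔞` in the model ring.
Rendered: a surjective ring homomorphism from the model ring onto `A/𝔞` with that kernel,
through which `ofBase` reduces to `A → A/𝔞`. [cite: DeJong1996, 3.5, p. 64] -/
theorem exists_ringHom_nodeDeformationRing_quotient {A : Type} [CommRing A] (h : A) (𝔞 : Ideal A)
    (hh : h ∈ 𝔞) :
    ∃ ψ : DeJong1996.NodeDeformationRing A h →+* A ⧸ 𝔞, Function.Surjective ψ ∧
      RingHom.ker ψ = 𝔞.map (DeJong1996.NodeDeformationRing.ofBase A h) ⊔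
        Ideal.span {Ideal.Quotient.mk _ (MvPowerSeries.X 0), Ideal.Quotient.mk _ (MvPowerSeries.X 1)} ∧
      ∀ a : A, ψ (DeJong1996.NodeDeformationRing.ofBase A h a) = Ideal.Quotient.mk 𝔞 a := by
  obtain ⟨hker, hsurj⟩ := ker_mk_comp_constantCoeff 2 𝔞
  set φ := (Ideal.Quotient.mk 𝔞).comp (MvPowerSeries.constantCoeff (σ := Fin 2) (R := A)) with hφ
  have hF : ∀ x ∈ Ideal.span {DeJong1996.nodeDeformationRelation A h}, φ x = 0 := by
    intro x hx
    rw [← RingHom.mem_ker]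
    refine (Ideal.span_le.mpr ?_) hx
    rw [Set.singleton_subset_iff, SetLike.mem_coe, RingHom.mem_ker, hφ, RingHom.comp_apply,
      DeJong1996.nodeDeformationRelation, map_sub, map_mul, MvPowerSeries.constantCoeff_X,
      zero_mul, zero_sub, MvPowerSeries.constantCoeff_C, map_neg, neg_eq_zero,
      Ideal.Quotient.eq_zero_iff_mem]
    exact hh
  refine ⟨Ideal.Quotient.lift _ φ hF, ?_, ?_, fun a => ?_⟩
  · exact Ideal.Quotient.lift_surjective_of_surjective _ hF hsurj
  · -- the kernel of the factored map is the image of the kernel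
    have h1 : RingHom.ker (Ideal.Quotient.lift _ φ hF) =
        (RingHom.ker φ).map (Ideal.Quotient.mk (Ideal.span {DeJong1996.nodeDeformationRelation A h})) := by
      apply le_antisymm
      · intro x hx
        obtain ⟨y, rfl⟩ := Ideal.Quotient.mk_surjective x
        rw [RingHom.mem_ker, Ideal.Quotient.lift_mk] at hx
        exact Ideal.mem_map_of_mem _ (RingHom.mem_ker.mpr hx)
      · rw [Ideal.map_le_iff_le_comap]
        intro y hy
        rw [Ideal.mem_comap, RingHom.mem_ker, Ideal.Quotient.lift_mk]
        exact hy
    rw [h1, hker, map_mk_sup_eq]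
  · rw [DeJong1996.NodeDeformationRing.ofBase_apply, Ideal.Quotient.lift_mk, hφ, RingHom.comp_apply,
      MvPowerSeries.constantCoeff_C]

/-! ## The centre ideals `(u, v, t_a, t_b)` -/

/-- **The centre ideal `(u, v, t_a, t_b)` of `A⟦u, v⟧/(uv - h)` is prime with quotient the
regular local ring `A/(t_a, t_b)`**, for `t` a regular system of parameters of the regular local
`A`, `a ≠ b` and `h ∈ (t_a, t_b)` (e.g. `h = t₁ ⋯ t_s`, `a < s`). Rendered: the ideal
`(t_a, t_b) · R + (u, v)` is prime and `R` modulo it is a regular local ring.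
[cite: DeJong1996, 3.5, p. 64] [cite: DeJong1997, proof of Prop. 5.11, p. 619] -/
theorem isPrime_centreIdeal_nodeDeformationRing {A : Type} [CommRing A] [IsRegularLocalRing A]
    {m : ℕ} (t : Fin m → A) (ht : Ideal.span (Set.range t) = maximalIdeal A)
    (hdim : ringKrullDim A = m) (h : A) {a b : Fin m} (hab : a ≠ b)
    (hh : h ∈ Ideal.span {t a, t b}) :
    ((Ideal.span {t a, t b}).map (DeJong1996.NodeDeformationRing.ofBase A h) ⊔
        Ideal.span {Ideal.Quotient.mk _ (MvPowerSeries.X 0),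
          Ideal.Quotient.mk _ (MvPowerSeries.X 1)}).IsPrime ∧
      IsRegularLocalRing (DeJong1996.NodeDeformationRing A h ⧸
        ((Ideal.span {t a, t b}).map (DeJong1996.NodeDeformationRing.ofBase A h) ⊔
          Ideal.span {Ideal.Quotient.mk _ (MvPowerSeries.X 0),
            Ideal.Quotient.mk _ (MvPowerSeries.X 1)})) := by
  have hrsop := isRsopPart_of_span_eq_of_ringKrullDim_eq t ht hdim
  -- `A/(t_a, t_b)` is a regular local ring
  have hpair : IsRsopPart (t ∘ ![a, b]) := by
    refine hrsop.comp ![a, b] ?_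
    intro i j hij
    fin_cases i <;> fin_cases j
    · rfl
    · exact absurd hij hab
    · exact absurd hij.symm hab
    · rfl
  have hrange : Set.range (t ∘ ![a, b]) = {t a, t b} := by
    ext x
    simp only [Set.mem_range, Function.comp_apply, Set.mem_insert_iff, Set.mem_singleton_iff]
    constructor
    · rintro ⟨i, rfl⟩
      fin_cases i
      · exact Or.inl rfl
      · exact Or.inr rfl
    · rintro (rfl | rfl)
      · exact ⟨0, rfl⟩
      · exact ⟨1, rfl⟩
  haveI hregq : IsRegularLocalRing (A ⧸ Ideal.span {t a, t b}) := by
    have := hpair.isRegularLocalRing_quotient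
    rwa [hrange] at this
  haveI : IsDomain (A ⧸ Ideal.span {t a, t b}) := isDomain_of_isRegularLocalRing _
  obtain ⟨ψ, hψs, hψk, -⟩ := exists_ringHom_nodeDeformationRing_quotient h _ hh
  let e := (Ideal.quotEquivOfEq hψk.symm).trans (RingHom.quotientKerEquivOfSurjective hψs)
  refine ⟨?_, IsRegularLocalRing.of_ringEquiv e.symm⟩
  rw [← hψk]
  exact RingHom.ker_isPrime ψ

/-- **Distinct centre ideals are incomparable**: if `(u, v, t_a, t_b) ≤ (u, v, t_{a'}, t_{b'})`
in `A⟦u, v⟧/(uv - h)` (with `h ∈ (t_{a'}, t_{b'})`), then `a ∈ {a', b'}` and `b ∈ {a', b'}` —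
reduce to `A/(t_{a'}, t_{b'})`, where `t_a` vanishes only if `a ∈ {a', b'}` (members of a regular
system of parameters outside `S` do not lie in the ideal of those indexed by `S`).
[cite: DeJong1996, 4.27, p. 75] -/
theorem mem_pair_of_centreIdeal_le {A : Type} [CommRing A] [IsRegularLocalRing A]
    {m : ℕ} (t : Fin m → A) (ht : Ideal.span (Set.range t) = maximalIdeal A)
    (hdim : ringKrullDim A = m) (h : A) {a b a' b' : Fin m}
    (hh : h ∈ Ideal.span {t a', t b'})
    (hle : (Ideal.span {t a, t b}).map (DeJong1996.NodeDeformationRing.ofBase A h) ⊔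
        Ideal.span {Ideal.Quotient.mk _ (MvPowerSeries.X 0), Ideal.Quotient.mk _ (MvPowerSeries.X 1)} ≤
      (Ideal.span {t a', t b'}).map (DeJong1996.NodeDeformationRing.ofBase A h) ⊔
        Ideal.span {Ideal.Quotient.mk _ (MvPowerSeries.X 0), Ideal.Quotient.mk _ (MvPowerSeries.X 1)}) :
    (a = a' ∨ a = b') ∧ (b = a' ∨ b = b') := by
  have hrsop := isRsopPart_of_span_eq_of_ringKrullDim_eq t ht hdim
  obtain ⟨ψ, -, hψk, hψ⟩ := exists_ringHom_nodeDeformationRing_quotient h _ hh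
  -- `t_c ∈ (t_{a'}, t_{b'})` for `c = a, b`
  have key : ∀ c : Fin m, DeJong1996.NodeDeformationRing.ofBase A h (t c) ∈
      (Ideal.span {t a, t b}).map (DeJong1996.NodeDeformationRing.ofBase A h) ⊔
        Ideal.span {Ideal.Quotient.mk _ (MvPowerSeries.X 0), Ideal.Quotient.mk _ (MvPowerSeries.X 1)} →
      c = a' ∨ c = b' := by
    intro c hc
    have h1 : DeJong1996.NodeDeformationRing.ofBase A h (t c) ∈ RingHom.ker ψ := hψk ▸ hle hc
    rw [RingHom.mem_ker, hψ, Ideal.Quotient.eq_zero_iff_mem] at h1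
    by_contra hcon
    push Not at hcon
    have hS : c ∉ ({a', b'} : Set (Fin m)) := by
      rintro (rfl | rfl)
      · exact hcon.1 rfl
      · exact hcon.2 rfl
    apply hrsop.not_mem_span_image hS
    rwa [Set.image_insert_eq, Set.image_singleton]
  refine ⟨key a (Ideal.mem_sup_left (Ideal.mem_map_of_mem _ (Ideal.subset_span (by simp)))),
    key b (Ideal.mem_sup_left (Ideal.mem_map_of_mem _ (Ideal.subset_span (by simp))))⟩

/-- **`𝔭_{ab} ≤ 𝔭_{a'b'}` with `a < b`, `a' < b'` forces `(a, b) = (a', b')`.**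
[cite: DeJong1996, 4.27, p. 75] -/
theorem eq_of_centreIdeal_le {A : Type} [CommRing A] [IsRegularLocalRing A]
    {m : ℕ} (t : Fin m → A) (ht : Ideal.span (Set.range t) = maximalIdeal A)
    (hdim : ringKrullDim A = m) (h : A) {a b a' b' : Fin m} (hab : a < b) (hab' : a' < b')
    (hh : h ∈ Ideal.span {t a', t b'})
    (hle : (Ideal.span {t a, t b}).map (DeJong1996.NodeDeformationRing.ofBase A h) ⊔
        Ideal.span {Ideal.Quotient.mk _ (MvPowerSeries.X 0), Ideal.Quotient.mk _ (MvPowerSeries.X 1)} ≤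
      (Ideal.span {t a', t b'}).map (DeJong1996.NodeDeformationRing.ofBase A h) ⊔
        Ideal.span {Ideal.Quotient.mk _ (MvPowerSeries.X 0), Ideal.Quotient.mk _ (MvPowerSeries.X 1)}) :
    a = a' ∧ b = b' := by
  obtain ⟨ha, hb⟩ := mem_pair_of_centreIdeal_le t ht hdim h hh hle
  rcases ha with rfl | rfl <;> rcases hb with h1 | h1
  · exact absurd h1 (ne_of_lt hab).symm
  · exact ⟨rfl, h1⟩
  · subst h1
    exact absurd (hab.trans hab') (lt_irrefl _)
  · subst h1
    exact absurd hab (lt_irrefl _)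

/-- `V(u, v, x, y) ⊆ Sing` for the model ring with `x y ∣ h` (the sibling file's
`not_isRegularLocalRing_localization_nodeDeformationRing`, with the divisibility as a
hypothesis rather than in the type). [cite: DeJong1996, 4.27, p. 75] -/
theorem not_isRegularLocalRing_localization_nodeDeformationRing_of_dvd {A : Type} [CommRing A]
    [IsRegularLocalRing A] {x y h : A} (hdvd : x * y ∣ h)
    (𝔮 : Ideal (DeJong1996.NodeDeformationRing A h)) [𝔮.IsPrime]
    (hu : Ideal.Quotient.mk _ (MvPowerSeries.X 0) ∈ 𝔮)
    (hv : Ideal.Quotient.mk _ (MvPowerSeries.X 1) ∈ 𝔮)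
    (hx : DeJong1996.NodeDeformationRing.ofBase A _ x ∈ 𝔮)
    (hy : DeJong1996.NodeDeformationRing.ofBase A _ y ∈ 𝔮) :
    ¬ IsRegularLocalRing (Localization.AtPrime 𝔮) := by
  obtain ⟨h', rfl⟩ := hdvd
  exact not_isRegularLocalRing_localization_nodeDeformationRing x y h' 𝔮 hu hv hx hy

end Summit.ResolutionOfSingularities.ResolutionOfSingularities.Theorems

end
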